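import Summits.CriticalPhenomena.PercolationContinuityZ3.Theorems.PercNearOneGluingNoHeavyLowerTailThreePartitionSaturation
import Summits.CriticalPhenomena.PercolationContinuityZ3.Theorems.PercNearOneGluingNoHeavyLowerTailSahiC3CubeFive
import Summits.CriticalPhenomena.PercolationContinuityZ3.Theorems.PercNearOneGluingNoHeavyLowerTailSahiC3CombCubeFour
import Summits.CriticalPhenomena.PercolationContinuityZ3.Theorems.PercNearOneGluingNoHeavyLowerTailSahiGridPatternRoundingMin
import Summits.CriticalPhenomena.PercolationContinuityZ3.Theorems.PercNearOneGluingNoHeavyLowerTailSahiGridPatternRoundingShared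

/-!
# (★★) = (M⁺-3) ON FIVE LETTERS: twisted three-partition positivity, equivalently COEFFICIENTWISE Kahn `C₃`, on every ground set
# of size `≤ 5` — and `SahiGridPattern.ResolvedPos 5` (the two-valued part of the first open cell `[3]^5`) — IN THE KERNEL

Support file (cell `prim-sahi`, seat `prim-sahi-typer` gen 33; `--supports stmt-CriticalPhenomena-4575`; proposed `--computational`:
the closure of the `m = 5` theorems is the standard axioms plus EXACTLY the `native_decide` axioms already in the tree — the eight chunks
`SahiC3Cube.colourChunk_five_a/b0/b1/b2/c1/c2/c3`, `colourBase_five` behind `SahiC3Cube.colourCheck_five` (typer gen 27) and, through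
`threePartNT_nonneg_of_card_le_four`, `SahiC3Cube.checkCube_four` (P1).  NO new evaluation is performed here; no `sorry`.)

THE MATHEMATICS.  Three statements about a triple of increasing families `U, V, W ⊆ 2^ι` of a finite cube are the same
(`…ThreePartitionCombBridge(Converse)`, P3): (M⁺-3) comb positivity — `p ↦ E₃(μ_p; 1_U,1_V,1_W)` is a nonnegative combination of the
cubic tensor-Bernstein basis on `[0,1]^ι` (`SahiComb.CombPos`); nonnegativity of all `4^{|ι|}` three-copy fibre sums; and (★★) twisted
three-partition positivity `threePartNT τ ≥ 0` of all SECTIONS of the triple, every twist `τ`.  They were kernel theorems on ground sets of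
size `≤ 4` (`SahiC3CombCube.threePartNT_nonneg_of_card_le_four`, computational via `checkCube_four`; `≈ 7·10^{10}` sorted triples put
`checkCube 5` out of reach) and census-only at size `5` (ttrl2 `rcomb`, `1.93·10^{11}` fibre sums; P1 gen 12 `tpp5.c`, all twists; lit/typer
engines).  Meanwhile the tree HOLDS a comb certificate on five letters: typer gen 27's `SahiC3Cube.colourCheck_five` runs P1's tensor-Bernstein
DIGIT TEST — which certifies ALL fibre sums of a triple, i.e. `CombPos` (`SahiC3CombCube.combPos_sahiE_three_of_checkTriple`, P3) — on the
`4 061 113` triples co-generated by the 3-coloured antichains of `2^[5]`; only its VALUE-level consequence `sahiC3_cube_five` was drawn,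
because the saturation reduction used (`SahiAbsorbed.sahiPositive_three_of_colouring`) is value-level.  The comb-level saturation reduction
of `…ThreePartitionSaturation` (this generation: `ThreePartition.threePartNT_nonneg_of_colouring`, every ground set and twist) closes the gap:

* `combPos_colourMember_of_colourCheck` — `colourCheck m σ = true` ⟹ `CombPos` of every triple co-generated by a 3-coloured antichain of
  `2^[m]` (the certificate read at comb level);
* `threePartNT_nonneg_of_colourCheck` — `colourCheck m σ = true` ⟹ (★★) on the ground set `Fin m`, EVERY twist, ALL up-set triples;
* **`threePartNT_nonneg_cube_five`**, **`threePartNT_nonneg_of_card_le_five`** — (★★) on every ground set with `≤ 5` elements, every twist;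
* **`combPos_sahiE_three_of_card_le_five`** — **(M⁺-3) ON FIVE LETTERS**: for every finite `ι` with `|ι| ≤ 5` and all increasing
  `U, V, W ⊆ 2^ι`, `p ↦ E₃(μ_p; 1_U, 1_V, 1_W)` is comb-positive — Kahn's Conjecture 5 on `{0,1}^5` holds COEFFICIENTWISE in the cubic
  tensor-Bernstein basis (hence at every `p`, `sahiE_three_ind_nonneg_of_card_le_five`, recovering `sahiC3_cube_five`; and with
  density-free zero sets, `sahiE_three_ind_eq_zero_of_interior_zero_of_card_le_five`); family form `combPos_sahiE_three_family_of_card_le_five`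
  (= `MasterFamilyCombPos 3` restricted to `|ι| ≤ 5`);
* **`resolvedPos_five : SahiGridPattern.ResolvedPos 5`**, `resolvedPos_of_le_five` — the pattern inequality `sStarD ≥ 0` on every up-set
  triple of `[3]^5` RESOLVED on every axis (twisted Boolean shadows; P1 gen 12 `resolvedPos_iff_twistedTPP`; P1's kit census j139056 of
  twisted three-partition positivity on five letters, one engine, is now a kernel theorem).
* THE FIRST OPEN CELL `(5,3) = [3]^5` IS THE PURE ROUNDING ALTERNATIVE.  P1's rounding calculus (gens 12–14) splits `PatternPos d`
  LOSSLESSLY into `ResolvedPos d` and a rounding alternative (`patternPos_iff_resolvedPos_and_roundingAlternativeMin/Neg`); the two-valued half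
  now drops out at `d = 5`: **`SahiGridPattern.patternPos_five_iff_roundingAlternativeMin : PatternPos 5 ↔ RoundingAlternativeMin 5`** (the cell
  holds iff every NEGATIVE lexicographic minimiser among the up-set triples of `[3]^5` is resolved on every axis),
  `patternPos_five_iff_roundingAlternativeNeg`, `patternPos_five_of_roundingAlternative`, `patternPos_five_of_sharedRoundingAlternative`,
  `liebSahiContinuum_five_three_of_roundingAlternativeMin` (Lieb–Sahi's Conjecture 1.1 on `[0,1]^5` at order 3 from the lex-minimiser
  alternative alone).  (`CombinedAlternative 4 → PatternPos 5`, which also consumes gen 32's `patternPos_four`, is filed separately.)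
HONEST LABEL: computational (closure = standard axioms + the nine named `native_decide` axioms above, all pre-existing);
`RoundingAlternativeMin 5`, `PatternPos 5`, (★★)/(M⁺-3) on six or more letters, Kahn's Conjecture 5 and Sahi's `C₃` remain OPEN and nothing
here asserts them. [this work]
-/

namespace Summit.CriticalPhenomena.PercolationContinuityZ3.Theorems

open Finset Function
open Literature.Combinatorics.Sahi2008
open Literature.Probability.Percolation.DecisionTree (ind)
open SahiComb

namespace SahiC3Cube

open OneCutCert CovTransferCert
open scoped Classical

/-- **The coloured-antichain certificate read at COMB level**: if `colourCheck m σ = true` then for every antichain `N ⊆ 2^[m]` and every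
colouring `c : 2^[m] → Fin 3`, `p ↦ E₃(μ_p; 1_{U_0}, 1_{U_1}, 1_{U_2})` is comb-positive for the co-generated triple
`U_i = {S | ∀ T ∈ N, c T = i → ¬ S ⊆ T}` (the digit test certifies every fibre sum: `SahiC3CombCube.combPos_sahiE_three_of_checkTriple`).
[this work] -/
theorem combPos_colourMember_of_colourCheck {m σ : ℕ} (h : colourCheck m σ = true) (N : Finset (Set (Fin m)))
    (c : Set (Fin m) → Fin 3) (hN : IsAntichain (· ≤ ·) (N : Set (Set (Fin m)))) :
    CombPos (fun _ : Fin m => 3) (fun p => sahiE (bernoulliWeight p) 3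
      ![ind {S | ∀ T ∈ N, c T = 0 → ¬ S ⊆ T}, ind {S | ∀ T ∈ N, c T = 1 → ¬ S ⊆ T}, ind {S | ∀ T ∈ N, c T = 2 → ¬ S ⊆ T}]) := by
  have hE : ∀ x ∈ N.image encS, x < 2 ^ m := by
    intro x hx
    obtain ⟨T, -, rfl⟩ := mem_image.1 hx
    exact encS_lt T
  have hanti : ∀ x ∈ N.image encS, ∀ y ∈ N.image encS, x ≠ y → x &&& y ≠ x := by
    intro x hx y hy hxy hland
    obtain ⟨T, hT, rfl⟩ := mem_image.1 hx
    obtain ⟨T', hT', rfl⟩ := mem_image.1 hy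
    have hsub : T ⊆ T' := by
      have := (land_eq_self_iff_pt_subset (encS T') (encS_lt T)).1 hland
      rwa [pt_encS, pt_encS] at this
    have hne : T ≠ T' := fun h => hxy (by rw [h])
    exact hN (mem_coe.2 hT) (mem_coe.2 hT') hne hsub
  have key := checkTriple_of_colourCheck h (N.image encS) (fun x => c (pt m x)) hE hanti
  rw [← encA_colourMember N c 0, ← encA_colourMember N c 1, ← encA_colourMember N c 2] at key
  exact SahiC3CombCube.combPos_sahiE_three_of_checkTriple key

/-- **(★★) on `Fin m` from the coloured-antichain check**: `colourCheck m σ = true` ⟹ `threePartNT τ U V W ≥ 0` for EVERY twist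
`τ ⊆ Fin m` and ALL increasing `U, V, W ⊆ 2^[m]` — comb certificates on the co-generated triples (`combPos_colourMember_of_colourCheck`,
transferred to every twist by `ThreePartition.threePartNT_nonneg_of_combPos`) and the comb-level saturation reduction
`ThreePartition.threePartNT_nonneg_of_colouring`. [this work] -/
theorem threePartNT_nonneg_of_colourCheck {m σ : ℕ} (h : colourCheck m σ = true) (τ : Set (Fin m))
    {U V W : Set (Set (Fin m))} (hU : IsUpperSet U) (hV : IsUpperSet V) (hW : IsUpperSet W) :
    0 ≤ ThreePartition.threePartNT τ U V W :=
  ThreePartition.threePartNT_nonneg_of_colouring τ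
    (fun N c hN => ThreePartition.threePartNT_nonneg_of_combPos τ (combPos_colourMember_of_colourCheck h N c hN)) hU hV hW

end SahiC3Cube

namespace SahiC3CombCube

open scoped Classical

/-- **(★★) ON THE FIVE-CUBE, every twist**: `threePartNT τ U V W ≥ 0` for all increasing `U, V, W ⊆ 2^[5]` and every `τ ⊆ Fin 5`
(certificate `SahiC3Cube.colourCheck_five`). [this work] -/
theorem threePartNT_nonneg_cube_five (τ : Set (Fin 5)) {U V W : Set (Set (Fin 5))} (hU : IsUpperSet U) (hV : IsUpperSet V)
    (hW : IsUpperSet W) : 0 ≤ ThreePartition.threePartNT τ U V W :=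
  SahiC3Cube.threePartNT_nonneg_of_colourCheck SahiC3Cube.colourCheck_five τ hU hV hW

/-- **(★★) on every ground set with at most five elements, every twist** (size `≤ 4`: `threePartNT_nonneg_of_card_le_four`; size `5`:
transport along `Fin 5 ≃ ι`, `ThreePartition.threePartNT_comap_equiv`). [this work] -/
theorem threePartNT_nonneg_of_card_le_five {ι : Type} [Fintype ι] (hι : Fintype.card ι ≤ 5) (τ : Set ι)
    {U V W : Set (Set ι)} (hU : IsUpperSet U) (hV : IsUpperSet V) (hW : IsUpperSet W) :
    0 ≤ ThreePartition.threePartNT τ U V W := by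
  rcases Nat.lt_or_ge (Fintype.card ι) 5 with h | h
  · exact threePartNT_nonneg_of_card_le_four (by omega) τ hU hV hW
  · have h5 : Fintype.card ι = 5 := le_antisymm hι h
    let φ : Fin 5 ≃ ι := (Fintype.equivFinOfCardEq h5).symm
    rw [← ThreePartition.threePartNT_comap_equiv φ τ U V W]
    exact threePartNT_nonneg_cube_five (φ ⁻¹' τ) (SahiC4CombBridge.isUpperSet_comapFam φ.symm hU)
      (SahiC4CombBridge.isUpperSet_comapFam φ.symm hV) (SahiC4CombBridge.isUpperSet_comapFam φ.symm hW)

/-- The untwisted slice: `threePartN U V W ≥ 0` (three-partition positivity of `…ThreePartitionAD`) on ground sets of size `≤ 5`. [this work] -/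
theorem threePartN_nonneg_of_card_le_five {ι : Type} [Fintype ι] (hι : Fintype.card ι ≤ 5)
    {U V W : Set (Set ι)} (hU : IsUpperSet U) (hV : IsUpperSet V) (hW : IsUpperSet W) :
    0 ≤ ThreePartition.threePartN U V W := by
  rw [← ThreePartition.threePartNT_empty]
  exact threePartNT_nonneg_of_card_le_five hι ∅ hU hV hW

/-- **(M⁺-3) ON FIVE LETTERS — COEFFICIENTWISE KAHN `C₃` ON `{0,1}^5`.**  For every finite `ι` with at most five elements and all
increasing `U, V, W ⊆ 2^ι`, the polynomial `p ↦ E₃(μ_p; 1_U, 1_V, 1_W)` is a nonnegative combination of the cubic tensor-Bernstein basis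
`∏_e p_e^{j_e}(1−p_e)^{3−j_e}` on `[0,1]^ι` (every three-copy fibre sum is `≥ 0`).  Proof: the coefficient at a profile `j` is
`threePartNT` of the `j`-sections on the active coordinates (`ThreePartition.combCoef3_eq_threePartNT`), a ground set of size `≤ |ι| ≤ 5`.
[this work] -/
theorem combPos_sahiE_three_of_card_le_five {ι : Type} [Fintype ι] (hι : Fintype.card ι ≤ 5) {U V W : Set (Set ι)}
    (hU : IsUpperSet U) (hV : IsUpperSet V) (hW : IsUpperSet W) :
    CombPos (fun _ : ι => 3) (fun p => sahiE (bernoulliWeight p) 3 ![ind U, ind V, ind W]) := by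
  refine ThreePartition.combPos_sahiE_three_of_combCoef3_nonneg fun j => ?_
  by_cases hj : ∀ e, j e ≤ 3
  · rw [ThreePartition.combCoef3_eq_threePartNT U V W hj]
    have hcard : Fintype.card (ThreePartition.Act j) ≤ 5 := (Fintype.card_subtype_le _).trans hι
    exact_mod_cast threePartNT_nonneg_of_card_le_five hcard (ThreePartition.twist j)
      (ThreePartition.isUpperSet_secFam j hU) (ThreePartition.isUpperSet_secFam j hV) (ThreePartition.isUpperSet_secFam j hW)
  · rw [ThreePartition.combCoef3_eq_zero_of_not_le U V W hj]

/-- (M⁺-3) on five letters in the shape of `MasterFamilyCombPos 3` (families `U : Fin 3 → Set (Set ι)`, `|ι| ≤ 5`). [this work] -/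
theorem combPos_sahiE_three_family_of_card_le_five {ι : Type} [Fintype ι] (hι : Fintype.card ι ≤ 5)
    (U : Fin 3 → Set (Set ι)) (hU : ∀ j, IsUpperSet (U j)) :
    CombPos (fun _ : ι => 3) (fun p => sahiE (bernoulliWeight p) 3 (fun j => ind (U j))) :=
  (ThreePartition.combPos_vec_iff U).2 (combPos_sahiE_three_of_card_le_five hι (hU 0) (hU 1) (hU 2))

/-- Value level recovered: Kahn's Conjecture 5 / Sahi's `C₃` for every product measure on at most five letters, every triple of increasing
events (for `ι = Fin 5` this is typer gen 27's `sahiC3_cube_five`, now via the comb certificate). [this work] -/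
theorem sahiE_three_ind_nonneg_of_card_le_five {ι : Type} [Fintype ι] (hι : Fintype.card ι ≤ 5)
    (U : Fin 3 → Set (Set ι)) (hU : ∀ j, IsUpperSet (U j)) (p : ι → unitInterval) :
    0 ≤ sahiE (bernoulliWeight p) 3 (fun j => ind (U j)) :=
  (combPos_sahiE_three_family_of_card_le_five hι U hU).nonneg p

/-- **Density-free zero set of `E₃` on five letters** ((M⁺-3) ⇒ (EQ⁰-3)): if `E₃(μ_q; 1_U) = 0` at ONE point `q` of the open cube
`(0,1)^ι`, `|ι| ≤ 5`, then `E₃(μ_p; 1_U) = 0` at EVERY `p ∈ [0,1]^ι`. [this work] -/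
theorem sahiE_three_ind_eq_zero_of_interior_zero_of_card_le_five {ι : Type} [Fintype ι] (hι : Fintype.card ι ≤ 5)
    {U : Fin 3 → Set (Set ι)} (hU : ∀ j, IsUpperSet (U j)) {q : ι → unitInterval}
    (hq : ∀ e, (q e : ℝ) ∈ Set.Ioo (0 : ℝ) 1) (h0 : sahiE (bernoulliWeight q) 3 (fun j => ind (U j)) = 0)
    (p : ι → unitInterval) : sahiE (bernoulliWeight p) 3 (fun j => ind (U j)) = 0 :=
  (combPos_sahiE_three_family_of_card_le_five hι U hU).eq_zero_of_interior hq h0 p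

/-- **`ResolvedPos 5`**: the pattern inequality `sStarD A B C ≥ 0` holds for every triple of up-sets of `[3]^5` resolved on every axis
(the twisted Boolean shadows — P1 gen 12's two-valued obligation of the rounding reduction for the first open cell `(5,3)`), because
`ResolvedPos d` IS twisted three-partition positivity on `d` letters (`SahiGridPattern.resolvedPos_iff_twistedTPP`). [this work] -/
theorem resolvedPos_five : SahiGridPattern.ResolvedPos 5 :=
  SahiGridPattern.resolvedPos_iff_twistedTPP.2 fun τ _ _ _ h𝒰 h𝒱 h𝒲 => threePartNT_nonneg_cube_five τ h𝒰 h𝒱 h𝒲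

/-- `ResolvedPos d` for every `d ≤ 5`. [this work] -/
theorem resolvedPos_of_le_five {d : ℕ} (hd : d ≤ 5) : SahiGridPattern.ResolvedPos d :=
  SahiGridPattern.resolvedPos_iff_twistedTPP.2 fun τ _ _ _ h𝒰 h𝒱 h𝒲 =>
    threePartNT_nonneg_of_card_le_five (by simpa using hd) τ h𝒰 h𝒱 h𝒲

end SahiC3CombCube

/-! ## The first open cell `(5,3)`: `PatternPos 5` is the pure rounding alternative -/

namespace SahiGridPattern

open SahiC3CombCube (resolvedPos_five)

/-- **THE CELL `(5,3)` IS THE ROUNDING ALTERNATIVE AT NEGATIVE LEX-MINIMISERS**: `PatternPos 5 ↔ RoundingAlternativeMin 5` — the pattern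
inequality on `[3]^5` (hence Kahn's Conjecture 5 / `C₃` for every product weight on every five-dimensional grid and `L(5,3)`) holds iff every
negative lexicographic minimiser among the up-set triples of `[3]^5` is resolved on every axis (by `IsLexMin.lt_rnd`: iff no negative
lex-minimiser has an unresolved axis on which all `16` simultaneous roundings increase `sStarD`). [this work] [computational] -/
theorem patternPos_five_iff_roundingAlternativeMin : PatternPos 5 ↔ RoundingAlternativeMin 5 :=
  ⟨roundingAlternativeMin_of_patternPos, fun h => patternPos_of_roundingAlternativeMin h resolvedPos_five⟩

/-- `PatternPos 5 ↔ RoundingAlternativeNeg 5`: the cell `(5,3)` holds iff every NEGATIVE up-set triple of `[3]^5` with an unresolved axis admits,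
on some unresolved axis, a simultaneous rounding that does not increase `sStarD`. [this work] [computational] -/
theorem patternPos_five_iff_roundingAlternativeNeg : PatternPos 5 ↔ RoundingAlternativeNeg 5 :=
  ⟨roundingAlternativeNeg_of_patternPos, fun h => patternPos_of_roundingAlternativeNeg h resolvedPos_five⟩

/-- P1's full rounding alternative on `[3]^5` now gives `PatternPos 5` outright (gen 12 had `RoundingAlternative 5 → ResolvedPos 5 → PatternPos 5`).
[this work] [computational] -/
theorem patternPos_five_of_roundingAlternative (h : RoundingAlternative 5) : PatternPos 5 :=
  patternPos_of_roundingAlternative h resolvedPos_five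

/-- The shared-rounding alternative on `[3]^5` gives `PatternPos 5`. [this work] [computational] -/
theorem patternPos_five_of_sharedRoundingAlternative (h : SharedRoundingAlternative 5) : PatternPos 5 :=
  patternPos_of_shared h resolvedPos_five

/-- From the lex-minimiser rounding alternative alone: Lieb–Sahi's Conjecture 1.1 on `[0,1]^5` at order 3 (and, through `PatternPos 5`, `C₃` for
every product / FKG weight on every five-dimensional grid: `liebSahi_grid_of_patternPos`, `fkg_grid_of_patternPos`). [this work] [computational] -/
theorem liebSahiContinuum_five_three_of_roundingAlternativeMin (h : RoundingAlternativeMin 5) : LiebSahiContinuum 5 3 :=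
  liebSahiContinuum_of_patternPos (patternPos_five_iff_roundingAlternativeMin.2 h)

end SahiGridPattern

end Summit.CriticalPhenomena.PercolationContinuityZ3.Theorems
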